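import Summits.CriticalPhenomena.PercolationContinuityZ3.Theorems.SahiMasterFamilyFrame

/-!
# Preliminaries for the order-five step: slot bookkeeping at order five, the pairwise sandwich, the pairwise annihilator

Unit `prim-master-conj` (crux anchor stmt-CriticalPhenomena-4575); companion of `SahiMasterFamilyFourStep.lean`,
`SahiMasterFamilyAnnihilator.lean`, `SahiMasterFamilyFrame.lean`.  Tools for `E_5 ≥ 0` on 5-families with a `Z_4`
sub-family (K4-NOTES §8 of the unit):
* `sahiE_five_reindex` — `E_5(F) = E_5(G, D, W, X, Y)` for the slots `W = F m`, `D = F_{−m} i`, `G`, `X`, `Y` the apex and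
  pair of the `Z_3`-triple inside `F_{−m,−i}`; `sahiE_four_of_perm` / `sahiE_five_swap01` — concrete slot permutations;
* `mem_of_union_mem_of_disjoint_esupp` and the **pairwise sandwich** (`inter_inter_hull_subset`): if on `Y ∩ K` the
  increasing event `D` ignores `esupp X`, on `X ∩ K` ignores `esupp Y` and on `X ∩ Y` ignores `esupp K`, then `D` agrees
  with its forced-open hull `K_D = {ω | ω ∪ (esupp X ∪ esupp Y ∪ esupp K) ∈ D}` on `X ∩ Y`, `X ∩ K` and `Y ∩ K`;
* the **pairwise annihilator identity** (`sahiE_five_of_pairwise_annihilator`): if `h` kills the pairwise products of a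
  frame `K, X, Y` whose pairs and triple have vanishing `E_2`, `E_3`, then
  `E_5(h, K, W, X, Y) = −E(Kh)E_3(W,X,Y) − E(Xh)E_3(W,K,Y) − E(Yh)E_3(W,K,X) − E(h)E_4(K,W,X,Y)`.
Everything proved; axioms standard. [this work]
-/

noncomputable section

open scoped Classical

namespace Summit.CriticalPhenomena.PercolationContinuityZ3.Theorems

open Finset Function
open Literature.Combinatorics.Sahi2008
open Literature.Probability.Percolation (DeterminedBy)
open Literature.Probability.LatticeModels.Kahn2022 (Affects)
open Literature.Probability.Percolation.DecisionTree (ind ind_of_mem ind_of_not_mem)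

/-! ### Slot bookkeeping at orders four and five -/

section Reindex

variable {α : Type*} [Fintype α]

/-- `E_4` along a concrete permutation of the slots. [this work] -/
theorem sahiE_four_of_perm (μ : α → ℝ) (f g : Fin 4 → α → ℝ) (σ : Equiv.Perm (Fin 4)) (h : ∀ j, g j = f (σ j)) :
    sahiE μ 4 g = sahiE μ 4 f := by
  have : g = fun j => f (σ j) := funext h
  rw [this, sahiE_comp_perm]

/-- `E_5` along a concrete permutation of the slots. [this work] -/
theorem sahiE_five_of_perm (μ : α → ℝ) (f g : Fin 5 → α → ℝ) (σ : Equiv.Perm (Fin 5)) (h : ∀ j, g j = f (σ j)) :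
    sahiE μ 5 g = sahiE μ 5 f := by
  have : g = fun j => f (σ j) := funext h
  rw [this, sahiE_comp_perm]

/-- Swapping the first two slots of `E_5`. [this work] -/
theorem sahiE_five_swap01 (μ : α → ℝ) (a b c d e : α → ℝ) :
    sahiE μ 5 ![a, b, c, d, e] = sahiE μ 5 ![b, a, c, d, e] :=
  sahiE_five_of_perm μ ![b, a, c, d, e] ![a, b, c, d, e] (Equiv.swap 0 1) fun j => by
    fin_cases j <;> rfl

/-- **Order-five reindexing**: for `m : Fin 5`, `i : Fin 4`, `i' : Fin 3`,
`E_5(F) = E_5(G, D, W, X, Y)` with `W = F m`, `D = F_{−m} i`, `G = F_{−m,−i} i'`, `X, Y` the other two slots. [this work] -/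
theorem sahiE_five_reindex (μ : α → ℝ) (F : Fin 5 → α → ℝ) (m : Fin 5) (i : Fin 4) (i' : Fin 3) :
    sahiE μ 5 F = sahiE μ 5 ![F (m.succAbove (i.succAbove i')), F (m.succAbove i), F m,
      F (m.succAbove (i.succAbove (i'.succAbove 0))), F (m.succAbove (i.succAbove (i'.succAbove 1)))] := by
  rw [sahiE_eq_cons_succAbove μ 3 F m,
    sahiE_eq_cons_succAbove μ 3 (Fin.cons (F m) (fun j => F (m.succAbove j)) : Fin 5 → α → ℝ) i.succ,
    sahiE_eq_cons_succAbove μ 3 _ i'.succ.succ]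
  congr 1
  funext j
  refine Fin.cases ?_ (fun k => ?_) j
  · simp only [Fin.cons_zero, Fin.cons_succ, Fin.succ_succAbove_succ, Matrix.cons_val_zero]
  · simp only [Fin.cons_succ, Matrix.cons_val_succ]
    refine Fin.cases ?_ (fun k' => ?_) k
    · simp only [Fin.succ_succAbove_zero, Fin.cons_zero, Matrix.cons_val_zero]
    · simp only [Fin.succ_succAbove_succ, Fin.cons_succ, Matrix.cons_val_succ]
      refine Fin.cases ?_ (fun k'' => ?_) k'
      · simp only [Fin.succ_succAbove_zero, Fin.cons_zero, Matrix.cons_val_zero]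
      · simp only [Fin.succ_succAbove_succ, Fin.cons_succ, Matrix.cons_val_succ]
        refine Fin.cases ?_ (fun k''' => ?_) k''
        · simp only [Matrix.cons_val_zero]
        · simp only [Matrix.cons_val_succ, Fin.eq_zero k''', Matrix.cons_val_fin_one]
          rfl

end Reindex

/-! ### The pairwise sandwich -/

section PairwiseSandwich

variable {ι : Type*} [Fintype ι]

/-- Removing unseen coordinates: if the increasing event `A` ignores the finite set `T` and `ω ∪ T ∈ A` then `ω ∈ A`.
[folklore] -/
theorem mem_of_union_mem_of_disjoint_esupp {A : Set (Set ι)} (hA : IsUpperSet A) {T : Finset ι}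
    (hT : Disjoint (esupp A) T) {ω : Set ι} (h : ω ∪ ↑T ∈ A) : ω ∈ A := by
  refine (mem_iff_of_inter_esupp_eq hA ?_).1 h
  ext j
  simp only [Set.mem_inter_iff, Set.mem_union, mem_coe]
  constructor
  · rintro ⟨hj | hj, hjA⟩
    · exact ⟨hj, hjA⟩
    · exact absurd hj (Finset.disjoint_left.1 hT hjA)
  · rintro ⟨hj, hjA⟩; exact ⟨Or.inl hj, hjA⟩

/-- **Pairwise sandwich.**  Let `X, Y, K` be nonempty increasing events and `D` increasing with
(i) `esupp X ⟂ esupp (Y ∩ K ∩ D)`, (ii) `esupp Y ⟂ esupp (X ∩ K ∩ D)`, (iii) `esupp K ⟂ esupp (X ∩ Y ∩ D)`.  Then on each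
pairwise intersection `X ∩ K`, `Y ∩ K`, `X ∩ Y` the event `D` agrees with its forced-open hull
`{ω | ω ∪ (esupp X ∪ esupp Y ∪ esupp K) ∈ D}`. [this work] -/
theorem inter_inter_hull_subset {X Y K D : Set (Set ι)} (hX : IsUpperSet X) (hY : IsUpperSet Y) (hK : IsUpperSet K)
    (hD : IsUpperSet D) (hXne : X.Nonempty) (hYne : Y.Nonempty) (hKne : K.Nonempty)
    (h1 : Disjoint (esupp X) (esupp (Y ∩ K ∩ D))) (h2 : Disjoint (esupp Y) (esupp (X ∩ K ∩ D)))
    (h3 : Disjoint (esupp K) (esupp (X ∩ Y ∩ D))) :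
    (X ∩ K ∩ {ω : Set ι | ω ∪ ↑(esupp X ∪ esupp Y ∪ esupp K) ∈ D} ⊆ D) ∧
      (Y ∩ K ∩ {ω : Set ι | ω ∪ ↑(esupp X ∪ esupp Y ∪ esupp K) ∈ D} ⊆ D) ∧
      (X ∩ Y ∩ {ω : Set ι | ω ∪ ↑(esupp X ∪ esupp Y ∪ esupp K) ∈ D} ⊆ D) := by
  have hXKD : IsUpperSet (X ∩ K ∩ D) := (hX.inter hK).inter hD
  have hYKD : IsUpperSet (Y ∩ K ∩ D) := (hY.inter hK).inter hD
  have hXYD : IsUpperSet (X ∩ Y ∩ D) := (hX.inter hY).inter hD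
  -- membership of a configuration containing the support
  have mX : ∀ {ω : Set ι}, ↑(esupp X) ⊆ ω → ω ∈ X := fun h => mem_of_esupp_subset hX hXne h
  have mY : ∀ {ω : Set ι}, ↑(esupp Y) ⊆ ω → ω ∈ Y := fun h => mem_of_esupp_subset hY hYne h
  have mK : ∀ {ω : Set ι}, ↑(esupp K) ⊆ ω → ω ∈ K := fun h => mem_of_esupp_subset hK hKne h
  have eS : ∀ ω : Set ι, ω ∪ ↑(esupp X ∪ esupp Y ∪ esupp K) =
      ω ∪ ↑(esupp X) ∪ ↑(esupp Y) ∪ ↑(esupp K) := fun ω => by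
    simp only [coe_union, Set.union_assoc]
  refine ⟨?_, ?_, ?_⟩
  · rintro ω ⟨⟨hωX, hωK⟩, hωS⟩
    simp only [Set.mem_setOf_eq, eS] at hωS
    -- `ω₃ = ω ∪ esupp Y ∈ X ∩ Y ∩ K`
    have s1 : ω ∪ ↑(esupp Y) ∪ ↑(esupp K) ∈ Y ∩ K ∩ D := by
      refine mem_of_union_mem_of_disjoint_esupp hYKD h1.symm (ω := ω ∪ ↑(esupp Y) ∪ ↑(esupp K)) ?_
      refine ⟨⟨mY (by intro j hj; simp [hj]), mK (by intro j hj; simp [hj])⟩, ?_⟩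
      have : ω ∪ ↑(esupp Y) ∪ ↑(esupp K) ∪ ↑(esupp X) = ω ∪ ↑(esupp X) ∪ ↑(esupp Y) ∪ ↑(esupp K) := by
        ext j; simp only [Set.mem_union]; tauto
      rw [this]; exact hωS
    have s2 : ω ∪ ↑(esupp Y) ∈ X ∩ Y ∩ D := by
      refine mem_of_union_mem_of_disjoint_esupp hXYD h3.symm ?_
      exact ⟨⟨hX (Set.subset_union_left.trans Set.subset_union_left) hωX, mY (by intro j hj; simp [hj])⟩, s1.2⟩
    have s3 : ω ∈ X ∩ K ∩ D :=
      mem_of_union_mem_of_disjoint_esupp hXKD h2.symm ⟨⟨hX Set.subset_union_left hωX, hK Set.subset_union_left hωK⟩, s2.2⟩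
    exact s3.2
  · rintro ω ⟨⟨hωY, hωK⟩, hωS⟩
    simp only [Set.mem_setOf_eq, eS] at hωS
    have s1 : ω ∪ ↑(esupp X) ∪ ↑(esupp K) ∈ X ∩ K ∩ D := by
      refine mem_of_union_mem_of_disjoint_esupp hXKD h2.symm (ω := ω ∪ ↑(esupp X) ∪ ↑(esupp K)) ?_
      refine ⟨⟨mX (by intro j hj; simp [hj]), mK (by intro j hj; simp [hj])⟩, ?_⟩
      have : ω ∪ ↑(esupp X) ∪ ↑(esupp K) ∪ ↑(esupp Y) = ω ∪ ↑(esupp X) ∪ ↑(esupp Y) ∪ ↑(esupp K) := by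
        ext j; simp only [Set.mem_union]; tauto
      rw [this]; exact hωS
    have s2 : ω ∪ ↑(esupp X) ∈ X ∩ Y ∩ D := by
      refine mem_of_union_mem_of_disjoint_esupp hXYD h3.symm ?_
      exact ⟨⟨mX (by intro j hj; simp [hj]), hY (Set.subset_union_left.trans Set.subset_union_left) hωY⟩, s1.2⟩
    have s3 : ω ∈ Y ∩ K ∩ D :=
      mem_of_union_mem_of_disjoint_esupp hYKD h1.symm ⟨⟨hY Set.subset_union_left hωY, hK Set.subset_union_left hωK⟩, s2.2⟩
    exact s3.2
  · rintro ω ⟨⟨hωX, hωY⟩, hωS⟩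
    simp only [Set.mem_setOf_eq, eS] at hωS
    have s1 : ω ∪ ↑(esupp Y) ∪ ↑(esupp K) ∈ Y ∩ K ∩ D := by
      refine mem_of_union_mem_of_disjoint_esupp hYKD h1.symm (ω := ω ∪ ↑(esupp Y) ∪ ↑(esupp K)) ?_
      refine ⟨⟨mY (by intro j hj; simp [hj]), mK (by intro j hj; simp [hj])⟩, ?_⟩
      have : ω ∪ ↑(esupp Y) ∪ ↑(esupp K) ∪ ↑(esupp X) = ω ∪ ↑(esupp X) ∪ ↑(esupp Y) ∪ ↑(esupp K) := by
        ext j; simp only [Set.mem_union]; tauto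
      rw [this]; exact hωS
    have s2 : ω ∪ ↑(esupp K) ∈ X ∩ K ∩ D := by
      refine mem_of_union_mem_of_disjoint_esupp hXKD h2.symm (ω := ω ∪ ↑(esupp K)) ?_
      refine ⟨⟨hX (Set.subset_union_left.trans Set.subset_union_left) hωX, mK (by intro j hj; simp [hj])⟩, ?_⟩
      have : ω ∪ ↑(esupp K) ∪ ↑(esupp Y) = ω ∪ ↑(esupp Y) ∪ ↑(esupp K) := by
        ext j; simp only [Set.mem_union]; tauto
      rw [this]; exact s1.2
    have s3 : ω ∈ X ∩ Y ∩ D :=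
      mem_of_union_mem_of_disjoint_esupp hXYD h3.symm ⟨⟨hX Set.subset_union_left hωX, hY Set.subset_union_left hωY⟩, s2.2⟩
    exact s3.2

end PairwiseSandwich

/-! ### The pairwise annihilator identity at order five -/

section PairwiseAnnihilator

variable {α : Type*} [Fintype α]

/-- **Pairwise annihilator.**  If `h` kills the pairwise products of `K, X, Y` (`K·X·h = K·Y·h = X·Y·h = 0`) and the
frame `K, X, Y` has `E_2(X,Y) = E_2(K,X) = E_2(K,Y) = 0` and `E_3(K,X,Y) = 0`, then for every `W`
`E_5(h, K, W, X, Y) = −E(Kh)·E_3(W,X,Y) − E(Xh)·E_3(W,K,Y) − E(Yh)·E_3(W,K,X) − E(h)·E_4(K,W,X,Y)`. [this work] -/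
theorem sahiE_five_of_pairwise_annihilator (μ : α → ℝ) (h K W X Y : α → ℝ) (hKX : K * X * h = 0)
    (hKY : K * Y * h = 0) (hXY : X * Y * h = 0) (e2XY : sahiE μ 2 ![X, Y] = 0) (e2KX : sahiE μ 2 ![K, X] = 0)
    (e2KY : sahiE μ 2 ![K, Y] = 0) (e3 : sahiE μ 3 ![K, X, Y] = 0) :
    sahiE μ 5 ![h, K, W, X, Y] = -(ex μ (K * h) * sahiE μ 3 ![W, X, Y]) - ex μ (X * h) * sahiE μ 3 ![W, K, Y]
      - ex μ (Y * h) * sahiE μ 3 ![W, K, X] - ex μ h * sahiE μ 4 ![K, W, X, Y] := by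
  have hcons : (![h, K, W, X, Y] : Fin 5 → α → ℝ) = Fin.cons h ![K, W, X, Y] := by funext j; fin_cases j <;> rfl
  rw [hcons, sahiE_fin_cons, Fin.sum_univ_four]
  simp only [Matrix.cons_val_zero, Matrix.cons_val_one, Matrix.cons_val]
  -- slot `K`: `(Kh, W, X, Y)`, `Kh` kills `X`, `Y`
  have t0 : sahiE μ 4 (update ![K, W, X, Y] 0 (K * h)) = -(sahiE μ 3 ![W, X, Y] * ex μ (K * h)) := by
    have e : update (![K, W, X, Y] : Fin 4 → α → ℝ) 0 (K * h) = Fin.cons (K * h) (Fin.cons W ![X, Y]) := by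
      funext j; fin_cases j <;> rfl
    have hann : ∀ j : Fin 2, (![X, Y] : Fin 2 → α → ℝ) j * (K * h) = 0 := by
      intro j; fin_cases j
      · show X * (K * h) = 0; rw [mul_left_comm, ← mul_assoc]; exact hKX
      · show Y * (K * h) = 0; rw [mul_left_comm, ← mul_assoc]; exact hKY
    have e3' : (Fin.cons W ![X, Y] : Fin 3 → α → ℝ) = ![W, X, Y] := by funext j; fin_cases j <;> rfl
    rw [e, sahiE_cons_cons_of_mul_eq_zero μ 1 _ _ _ hann, e2XY, zero_mul, sub_zero, e3']
  -- slot `W`: `(K, Wh, X, Y)`: `Wh` kills all pairwise products of the frame ⇒ the term vanishes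
  have t1 : sahiE μ 4 (update ![K, W, X, Y] 1 (W * h)) = 0 := by
    have e : sahiE μ 4 (update ![K, W, X, Y] 1 (W * h)) = sahiE μ 4 ![W * h, K, X, Y] :=
      sahiE_four_of_perm μ ![W * h, K, X, Y] _ (Equiv.swap 0 1) fun j => by fin_cases j <;> rfl
    have hc : (![W * h, K, X, Y] : Fin 4 → α → ℝ) = Fin.cons (W * h) ![K, X, Y] := by funext j; fin_cases j <;> rfl
    rw [e, hc, sahiE_fin_cons, Fin.sum_univ_three, e3, zero_mul, sub_zero]
    simp only [Matrix.cons_val_zero, Matrix.cons_val_one, Matrix.cons_val]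
    have u0 : update (![K, X, Y] : Fin 3 → α → ℝ) 0 (K * (W * h)) = Fin.cons (K * (W * h)) ![X, Y] := by
      funext j; fin_cases j <;> rfl
    have u1 : sahiE μ 3 (update (![K, X, Y] : Fin 3 → α → ℝ) 1 (X * (W * h))) =
        sahiE μ 3 (Fin.cons (X * (W * h)) ![K, Y] : Fin 3 → α → ℝ) := by
      have : update (![K, X, Y] : Fin 3 → α → ℝ) 1 (X * (W * h)) = ![K, X * (W * h), Y] := by
        funext j; fin_cases j <;> rfl
      rw [this, sahiE_eq_cons_succAbove μ 1 _ 1]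
      congr 1; funext j; fin_cases j <;> rfl
    have u2 : sahiE μ 3 (update (![K, X, Y] : Fin 3 → α → ℝ) 2 (Y * (W * h))) =
        sahiE μ 3 (Fin.cons (Y * (W * h)) ![K, X] : Fin 3 → α → ℝ) := by
      have : update (![K, X, Y] : Fin 3 → α → ℝ) 2 (Y * (W * h)) = ![K, X, Y * (W * h)] := by
        funext j; fin_cases j <;> rfl
      rw [this, sahiE_eq_cons_succAbove μ 1 _ 2]
      congr 1; funext j; fin_cases j <;> rfl
    have a0 : ∀ j : Fin 2, (![X, Y] : Fin 2 → α → ℝ) j * (K * (W * h)) = 0 := by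
      intro j; fin_cases j
      · show X * (K * (W * h)) = 0
        rw [show X * (K * (W * h)) = W * (K * X * h) by ring, hKX, mul_zero]
      · show Y * (K * (W * h)) = 0
        rw [show Y * (K * (W * h)) = W * (K * Y * h) by ring, hKY, mul_zero]
    have a1 : ∀ j : Fin 2, (![K, Y] : Fin 2 → α → ℝ) j * (X * (W * h)) = 0 := by
      intro j; fin_cases j
      · show K * (X * (W * h)) = 0
        rw [show K * (X * (W * h)) = W * (K * X * h) by ring, hKX, mul_zero]
      · show Y * (X * (W * h)) = 0
        rw [show Y * (X * (W * h)) = W * (X * Y * h) by ring, hXY, mul_zero]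
    have a2 : ∀ j : Fin 2, (![K, X] : Fin 2 → α → ℝ) j * (Y * (W * h)) = 0 := by
      intro j; fin_cases j
      · show K * (Y * (W * h)) = 0
        rw [show K * (Y * (W * h)) = W * (K * Y * h) by ring, hKY, mul_zero]
      · show X * (Y * (W * h)) = 0
        rw [show X * (Y * (W * h)) = W * (X * Y * h) by ring, hXY, mul_zero]
    rw [u0, u1, u2, SahiMeetTowerAll.sahiE_cons_of_mul_eq_zero μ 1 _ _ a0,
      SahiMeetTowerAll.sahiE_cons_of_mul_eq_zero μ 1 _ _ a1,
      SahiMeetTowerAll.sahiE_cons_of_mul_eq_zero μ 1 _ _ a2, e2XY, e2KY, e2KX]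
    ring
  -- slot `X`: `(K, W, Xh, Y) ~ (Xh, W, K, Y)`, `Xh` kills `K`, `Y`
  have t2 : sahiE μ 4 (update ![K, W, X, Y] 2 (X * h)) = -(sahiE μ 3 ![W, K, Y] * ex μ (X * h)) := by
    have e : sahiE μ 4 (update ![K, W, X, Y] 2 (X * h)) =
        sahiE μ 4 (Fin.cons (X * h) (Fin.cons W ![K, Y]) : Fin 4 → α → ℝ) :=
      sahiE_four_of_perm μ _ _ (Equiv.swap 0 2) fun j => by fin_cases j <;> rfl
    have hann : ∀ j : Fin 2, (![K, Y] : Fin 2 → α → ℝ) j * (X * h) = 0 := by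
      intro j; fin_cases j
      · show K * (X * h) = 0; rw [← mul_assoc]; exact hKX
      · show Y * (X * h) = 0; rw [mul_left_comm, ← mul_assoc]; exact hXY
    have e3' : (Fin.cons W ![K, Y] : Fin 3 → α → ℝ) = ![W, K, Y] := by funext j; fin_cases j <;> rfl
    rw [e, sahiE_cons_cons_of_mul_eq_zero μ 1 _ _ _ hann, e2KY, zero_mul, sub_zero, e3']
  -- slot `Y`: `(K, W, X, Yh) ~ (Yh, W, K, X)`, `Yh` kills `K`, `X`
  have t3 : sahiE μ 4 (update ![K, W, X, Y] 3 (Y * h)) = -(sahiE μ 3 ![W, K, X] * ex μ (Y * h)) := by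
    have e : sahiE μ 4 (update ![K, W, X, Y] 3 (Y * h)) =
        sahiE μ 4 (Fin.cons (Y * h) (Fin.cons W ![K, X]) : Fin 4 → α → ℝ) :=
      sahiE_four_of_perm μ _ _ (Equiv.swap 0 2 * Equiv.swap 2 3) fun j => by fin_cases j <;> rfl
    have hann : ∀ j : Fin 2, (![K, X] : Fin 2 → α → ℝ) j * (Y * h) = 0 := by
      intro j; fin_cases j
      · show K * (Y * h) = 0; rw [← mul_assoc]; exact hKY
      · show X * (Y * h) = 0; rw [← mul_assoc]; exact hXY
    have e3' : (Fin.cons W ![K, X] : Fin 3 → α → ℝ) = ![W, K, X] := by funext j; fin_cases j <;> rfl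
    rw [e, sahiE_cons_cons_of_mul_eq_zero μ 1 _ _ _ hann, e2KX, zero_mul, sub_zero, e3']
  rw [t0, t1, t2, t3]
  ring

end PairwiseAnnihilator

end Summit.CriticalPhenomena.PercolationContinuityZ3.Theorems
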